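import Literature.Geometry.Lorentzian.DataHypersurfaceLocalTrichotomy
import HarnessLib

/-!
# Compact shadows persist slightly to the future (the shadow form of the openness of the domain
# of dependence of an acausal hypersurface; O'Neill 1983, Lemma 14.43, without limit curves)

Pure causality. Let `(M, g, τ)` be a time-oriented Lorentzian manifold in which the causal
relation is sequentially closed (`hrel`) and the sets `J⁺(C) ∩ J⁻(y)` are compact for compact `C`
(`hKC`) — consequences of global hyperbolicity in the form displayed throughout the
Choquet-Bruhat–Geroch files —, satisfying the causality condition; let `ι : X → M` be an
injective continuous map from a locally compact space whose image `S = ι(X)` is ACAUSAL and has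
the LOCALISED TRICHOTOMY property of `DataHypersurfaceLocalTrichotomy` (the image of a data
embedding, i.e. a smooth spacelike hypersurface, has it). The **causal shadow** of a point `x` on
the hypersurface is `ι⁻¹ J⁻(x) ⊆ X`.

**Theorem (`exists_ll_compactShadow`).** If `x ∈ S ∪ I⁺(S)` has causal shadow contained in a
compact subset of `X`, then so does some `x⁺ ≫ x`.

For a point of `S` the shadow is the point itself (acausality), so every point of the
hypersurface is chronologically below a compact-shadow point; by heredity (`J⁻(y) ⊆ J⁻(x⁺)` for
`y ≤ x⁺`) the sets `I⁻(x⁺) ∩ I⁺(S)` over compact-shadow points `x⁺` then cover a neighbourhood of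
`S` from above. This replaces, in the shadow route to the domain of dependence, the openness of
`D(S)` (O'Neill 1983, Ch. 14, Lemma 14.43; Hawking–Ellis 1973, Prop. 6.6.6), whose printed proofs
use limit curves.

**Proof.** Let `ι⁻¹ J⁻(x) ⊆ K`, `K` compact, and `K' ⊇ K` a compact neighbourhood of `K`;
`L = ι(K')`. Points `x_k ↓ x` on a future timelike curve from `x` lie in `I⁺(L)`. If no `x_k` had
compact shadow, there were `u_k ∉ K'` with `ι u_k ≤ x_k`, i.e. causal curves `β_k` from
`ι u_k ∉ J⁺(L)` to `x_k ∈ int J⁺(L)`; their first points `w_k` in the closed set `J⁺(L)` lie on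
`∂J⁺(L)` and in the compact `J⁺(L) ∩ J⁻(x_0)`, so `w_k → w` along a subsequence, with `w ≤ x`
(closedness), `w ∉ int J⁺(L) ⊇ I⁺(L)` and `l ≤ w` for some `l ∈ L ⊆ S`. Every `z ∈ S` with
`z ≪ w` satisfies `z ≪ x`, hence lies in `ι(K) ⊆ L` — impossible; so `I⁻(w) ∩ S = ∅`. If `l ≠ w`
then `w ∉ S` (acausality) and `w ∈ J⁺(S) ∖ S ⊆ I⁺(S)` (`causalFuture_subset_of_localTrichotomy`) —
contradiction. If `l = w ∈ S ∩ J⁻(x)` then `w = ι v` with `v ∈ K ⊆ int K'`, and the trichotomy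
neighbourhood `B` of `w` for `O = int K'` contains `w_k` for large `k`: `w_k ∈ ι(O)` contradicts
`ι u_k ≤ w_k`, `u_k ∉ K'` (acausality, injectivity); `w_k ∈ I⁺(ι O) ⊆ int J⁺(L)` contradicts
`w_k ∈ ∂J⁺(L)`; `w_k ∈ I⁻(ι O)` gives `ι u_k ≤ w_k ≪ ι o`, two related points of `S`.

Also: `exists_first_entry` (first parameter of a path in a closed set),
`isClosed_causalFuture_of_isCompact_of_rel` (`J⁺(C)` is closed for compact `C` when `≤` is
sequentially closed), and the time dual `exists_gg_compactShadow`.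

Everything is proved; no definitions, no named facts (D-0026).

## References

* B. O'Neill, *Semi-Riemannian geometry with applications to relativity*, Academic Press 1983,
  Ch. 14, Def. 14.35, Lemma 14.43 (pp. 419–426), Lemma 14.22. [ONeillSemiRiemannian1983]
* S. W. Hawking, G. F. R. Ellis, *The large scale structure of space-time*, CUP 1973, §6.5–6.6,
  Prop. 6.6.6. [HawkingEllis1973CUP]
-/

noncomputable section

open Set Filter Function TopologicalSpace Topology
open scoped Manifold ContDiff Topology

namespace Literature.Geometry.Lorentzian

namespace LorentzianMetric

/-! ### First entry of a path into a closed set -/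

/-- **First entry.** If `β` is continuous on `[a, b]`, `β a ∉ F`, `β b ∈ F` and `F` is closed,
there is a first parameter `t ∈ (a, b]` with `β t ∈ F`; the point `β t` is not an interior point
of `F`. [folklore] -/
theorem exists_first_entry {M : Type*} [TopologicalSpace M] {F : Set M} (hF : IsClosed F)
    {β : ℝ → M} {a b : ℝ} (hab : a ≤ b) (hβ : ContinuousOn β (Icc a b)) (ha : β a ∉ F)
    (hb : β b ∈ F) :
    ∃ t ∈ Ioc a b, β t ∈ F ∧ β t ∉ interior F ∧ ∀ s ∈ Ico a t, β s ∉ F := by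
  set T : Set ℝ := Icc a b ∩ β ⁻¹' F with hT
  have hTc : IsClosed T := hβ.preimage_isClosed_of_isClosed isClosed_Icc hF
  have hTne : T.Nonempty := ⟨b, right_mem_Icc.2 hab, hb⟩
  have hTbdd : BddBelow T := ⟨a, fun s hs ↦ hs.1.1⟩
  set t := sInf T with ht
  have htT : t ∈ T := hTc.csInf_mem hTne hTbdd
  have hat : a < t := by
    rcases eq_or_lt_of_le htT.1.1 with h | h
    · exact absurd (h ▸ htT.2 : β a ∈ F) ha
    · exact h
  have hbefore : ∀ s ∈ Ico a t, β s ∉ F := fun s hs hsF ↦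
    not_lt.2 (csInf_le hTbdd ⟨⟨hs.1, hs.2.le.trans htT.1.2⟩, hsF⟩) hs.2
  refine ⟨t, ⟨hat, htT.1.2⟩, htT.2, fun hint ↦ ?_, hbefore⟩
  -- points `β s`, `s ↑ t`, would lie in the open set `interior F ⊆ F`
  have hcont : ContinuousWithinAt β (Icc a b) t := hβ t htT.1
  have hmem : β ⁻¹' interior F ∈ 𝓝[Icc a b] t :=
    hcont.preimage_mem_nhdsWithin (isOpen_interior.mem_nhds hint)
  rw [mem_nhdsWithin] at hmem
  obtain ⟨V, hVo, htV, hV⟩ := hmem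
  obtain ⟨ε, hε, hεV⟩ := Metric.isOpen_iff.1 hVo t htV
  set s := max a (t - ε / 2) with hs
  have hsa : a ≤ s := le_max_left _ _
  have hst : s < t := max_lt hat (by linarith)
  have hsV : s ∈ V := hεV (by
    rw [Metric.mem_ball, Real.dist_eq, abs_lt]
    constructor <;> [linarith [le_max_right a (t - ε / 2)]; linarith])
  have hsF : β s ∈ F := interior_subset (hV ⟨hsV, hsa, hst.le.trans htT.1.2⟩)
  exact hbefore s ⟨hsa, hst⟩ hsF

section Causal

variable {E : Type*} [NormedAddCommGroup E] [NormedSpace ℝ E] {H : Type*} [TopologicalSpace H]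
  {I : ModelWithCorners ℝ E H} {n : ℕ∞ω} {M : Type*} [TopologicalSpace M] [ChartedSpace H M]
  [IsManifold I ∞ M] [T2Space M] [SecondCountableTopology M] [BoundarylessManifold I M]
  [FiniteDimensional ℝ E] {g : LorentzianMetric I n M} {τ : TimeOrientation g}

/-! ### `J⁺(C)` is closed for compact `C` -/

omit [BoundarylessManifold I M] in
/-- **`J⁺(C)` is closed for compact `C`** when the causal relation is sequentially closed: limits
of points `y_j ≥ c_j`, `c_j ∈ C`, are above an accumulation point of the `c_j` (O'Neill 1983,
Lemma 14.22 with the compactness of `C`). [cite: ONeillSemiRiemannian1983, Ch. 14, Lemma 14.22 (p. 412)] -/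
theorem isClosed_causalFuture_of_isCompact_of_rel
    (hrel : ∀ {xs ys : ℕ → M} {x y : M}, Tendsto xs atTop (𝓝 x) → Tendsto ys atTop (𝓝 y) →
      (∀ j, ys j ∈ g.causalFuture τ {xs j}) → y ∈ g.causalFuture τ {x})
    {C : Set M} (hC : IsCompact C) : IsClosed (g.causalFuture τ C) := by
  haveI : LocallyCompactSpace M := Manifold.locallyCompact_of_finiteDimensional (M := M) I
  haveI : TopologicalSpace.MetrizableSpace M := Manifold.metrizableSpace I M
  letI : MetricSpace M := TopologicalSpace.metrizableSpaceMetric M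
  refine IsSeqClosed.isClosed fun ys y hys hy ↦ ?_
  have hc : ∀ j, ∃ c ∈ C, ys j ∈ g.causalFuture τ {c} := fun j ↦ by
    have h := hys j
    rw [causalFuture_eq_biUnion] at h
    simp only [mem_iUnion, exists_prop] at h
    exact h
  choose cs hcsC hcs using hc
  obtain ⟨c, hcC, φ, hφ, hφc⟩ := hC.tendsto_subseq hcsC
  have hyc : y ∈ g.causalFuture τ {c} :=
    hrel hφc (hy.comp hφ.tendsto_atTop) fun j ↦ hcs (φ j)
  rw [causalFuture_eq_biUnion]
  simp only [mem_iUnion, exists_prop]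
  exact ⟨c, hcC, hyc⟩

/-! ### Elementary consequences of acausality -/

omit [T2Space M] [SecondCountableTopology M] [BoundarylessManifold I M] [FiniteDimensional ℝ E] in
/-- In a causal spacetime, no point of an acausal set `ι(X)` is chronologically above a point of
`ι(X)`: `I⁺(ι X) ∩ ι(X) = ∅`. [cite: ONeillSemiRiemannian1983, Ch. 14, p. 425] -/
theorem not_mem_range_of_mem_chronologicalFuture_range (hcwb : g.IsCausallyWellBehaved τ)
    {X' : Type*} {ι : X' → M}
    (hac : ∀ p ∈ range ι, ∀ q ∈ range ι, q ∈ g.causalFuture τ {p} → q = p) {y : M}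
    (hy : y ∈ g.chronologicalFuture τ (range ι)) : y ∉ range ι := by
  intro hyS
  rw [chronologicalFuture_eq_biUnion] at hy
  simp only [mem_iUnion, exists_prop] at hy
  obtain ⟨z, hz, hyz⟩ := hy
  have heq : y = z := hac z hz y hyS (chronologicalFuture_subset_causalFuture g τ _ hyz)
  obtain ⟨w, hw, γ, a, b, hab, hγ, hγa, hγb⟩ := hyz
  rw [mem_singleton_iff] at hw
  exact hcwb.isChronological γ a b hab hγ (by rw [hγa, hγb, hw, heq])

/-! ### Compact shadows persist slightly to the future -/

/-- **Compact shadows persist slightly to the future.** Let `≤` be sequentially closed, the sets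
`J⁺(C) ∩ J⁻(y)` compact for compact `C`, the causality condition hold, and let `ι : X → M` be
injective and continuous from a locally compact space with acausal image having the localised
trichotomy property. If `x ∈ ι(X) ∪ I⁺(ι X)` has causal shadow `ι⁻¹ J⁻(x)` contained in a compact
set, then some `x⁺ ≫ x` has causal shadow contained in a compact set. See the module docstring
for the proof (no limit curves). [cite: ONeillSemiRiemannian1983, Ch. 14, Lemma 14.43 (pp. 425–426)]
[cite: HawkingEllis1973CUP, §6.6, Prop. 6.6.6] -/
theorem exists_ll_compactShadow (hn : 2 ≤ n) (hcwb : g.IsCausallyWellBehaved τ)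
    {X' : Type*} [TopologicalSpace X'] [LocallyCompactSpace X'] {ι : X' → M}
    (hιc : Continuous ι) (hιi : Injective ι)
    (hac : ∀ p ∈ range ι, ∀ q ∈ range ι, q ∈ g.causalFuture τ {p} → q = p)
    (hLT : ∀ (u : X') (O : Set X'), IsOpen O → u ∈ O → ∃ B : Set M, IsOpen B ∧ ι u ∈ B ∧
      B ⊆ ι '' O ∪ g.chronologicalFuture τ (ι '' O) ∪ g.chronologicalPast τ (ι '' O))
    (hrel : ∀ {xs ys : ℕ → M} {x y : M}, Tendsto xs atTop (𝓝 x) → Tendsto ys atTop (𝓝 y) →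
      (∀ j, ys j ∈ g.causalFuture τ {xs j}) → y ∈ g.causalFuture τ {x})
    (hKC : ∀ C : Set M, IsCompact C → ∀ y : M,
      IsCompact (g.causalFuture τ C ∩ g.causalPast τ {y}))
    {x : M} (hx : x ∈ range ι ∨ x ∈ g.chronologicalFuture τ (range ι))
    {K : Set X'} (hK : IsCompact K) (hsh : ι ⁻¹' g.causalPast τ {x} ⊆ K) :
    ∃ x' ∈ g.chronologicalFuture τ {x}, ∃ K' : Set X', IsCompact K' ∧
      ι ⁻¹' g.causalPast τ {x'} ⊆ K' := by
  classical
  have hn1 : (1 : ℕ∞ω) ≤ n := le_trans one_le_two hn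
  -- the global trichotomy and the horismos `J⁺(S) ⊆ S ∪ I⁺(S)`
  have hLT' : ∀ u : X', ∃ B : Set M, IsOpen B ∧ ι u ∈ B ∧
      B ⊆ range ι ∪ g.chronologicalFuture τ (range ι) ∪ g.chronologicalPast τ (range ι) := by
    intro u
    simpa only [image_univ] using hLT u univ isOpen_univ (mem_univ u)
  have hJS := causalFuture_subset_of_localTrichotomy hn hcwb hac hLT'
  -- a compact neighbourhood `K'` of `K`, `L = ι(K')`
  obtain ⟨K', hK', hKK'⟩ := exists_compact_superset hK
  set L : Set M := ι '' K' with hL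
  have hLc : IsCompact L := hK'.image hιc
  have hLS : L ⊆ range ι := image_subset_range _ _
  have hJLc : IsClosed (g.causalFuture τ L) := isClosed_causalFuture_of_isCompact_of_rel hrel hLc
  have hIL : g.chronologicalFuture τ L ⊆ interior (g.causalFuture τ L) :=
    interior_maximal (chronologicalFuture_subset_causalFuture g τ L)
      (isOpen_chronologicalFuture_of_boundaryless g τ L)
  -- points chronologically above `x` lie in `I⁺(L)`
  have hxL : ∀ x' ∈ g.chronologicalFuture τ {x}, x' ∈ g.chronologicalFuture τ L := by
    intro x' hx'
    rcases hx with ⟨u₀, rfl⟩ | hxI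
    · have hu₀ : u₀ ∈ K' := interior_subset (hKK' (hsh (subset_causalPast g τ _ rfl)))
      exact chronologicalFuture_mono (show ({ι u₀} : Set M) ⊆ L from
        singleton_subset_iff.2 ⟨u₀, hu₀, rfl⟩) hx'
    · rw [chronologicalFuture_eq_biUnion] at hxI
      simp only [mem_iUnion, exists_prop] at hxI
      obtain ⟨_, ⟨u₀, rfl⟩, hxu₀⟩ := hxI
      have hu₀ : u₀ ∈ K' := interior_subset (hKK' (hsh
        (mem_causalPast_singleton_iff.2 (chronologicalFuture_subset_causalFuture g τ _ hxu₀))))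
      exact chronologicalFuture_mono (show ({ι u₀} : Set M) ⊆ L from
        singleton_subset_iff.2 ⟨u₀, hu₀, rfl⟩) (mem_chronologicalFuture_trans hxu₀ hx')
  -- a future timelike curve `c` from `x` and the points `xs k = c (a + (b - a)/(k + 2)) ↓ x`
  obtain ⟨y, hy⟩ := exists_mem_chronologicalFuture_singleton (g := g) (τ := τ) hn x
  obtain ⟨x0, hx0, c, a, b, hab, hc, hca, hcb⟩ := hy
  rw [mem_singleton_iff] at hx0
  rw [hx0] at hca
  subst hca
  set ts : ℕ → ℝ := fun k ↦ a + (b - a) / ((k : ℝ) + 2) with hts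
  have hts_mem : ∀ k, ts k ∈ Ioo a b := fun k ↦ by
    have hk : (2 : ℝ) ≤ (k : ℝ) + 2 := by linarith [(Nat.cast_nonneg k : (0 : ℝ) ≤ k)]
    have h1 : 0 < (b - a) / ((k : ℝ) + 2) := div_pos (by linarith) (by linarith)
    have h2 : (b - a) / ((k : ℝ) + 2) ≤ (b - a) / 2 :=
      div_le_div_of_nonneg_left (by linarith) (by norm_num) hk
    constructor <;> simp only [hts] <;> linarith
  have hts_lim : Tendsto ts atTop (𝓝 a) := by
    have h1 : Tendsto (fun k : ℕ ↦ (b - a) / ((k : ℝ) + 2)) atTop (𝓝 0) := by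
      have h2 : Tendsto (fun k : ℕ ↦ (k : ℝ) + 2) atTop atTop :=
        tendsto_atTop_add_const_right _ _ tendsto_natCast_atTop_atTop
      exact h2.const_div_atTop (b - a)
    simpa only [hts, add_zero] using tendsto_const_nhds.add h1
  set xs : ℕ → M := fun k ↦ c (ts k) with hxs
  have hxxs : ∀ k, xs k ∈ g.chronologicalFuture τ {c a} := fun k ↦
    ⟨c a, rfl, c, a, ts k, (hts_mem k).1, hc.mono (Icc_subset_Icc le_rfl (hts_mem k).2.le),
      rfl, rfl⟩
  have hxsb : ∀ k, c b ∈ g.chronologicalFuture τ {xs k} := fun k ↦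
    ⟨xs k, rfl, c, ts k, b, (hts_mem k).2, hc.mono (Icc_subset_Icc (hts_mem k).1.le le_rfl),
      rfl, rfl⟩
  have hxs_lim : Tendsto xs atTop (𝓝 (c a)) :=
    ((hc a (left_mem_Icc.2 hab.le)).1.continuousAt.tendsto).comp hts_lim
  -- suppose no `xs k` has compact shadow: escaping shadow points `u k ∉ K'`
  by_contra hcon
  push Not at hcon
  have hu : ∀ k, ∃ u : X', ι u ∈ g.causalPast τ {xs k} ∧ u ∉ K' := by
    intro k
    have h := hcon (xs k) (hxxs k) K' hK'
    rw [not_subset] at h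
    obtain ⟨u, hu, huK⟩ := h
    exact ⟨u, hu, huK⟩
  choose u huJ huK using hu
  -- `ι (u k) ∉ J⁺(L)` and `xs k ∈ int J⁺(L)`
  have hsL : ∀ k, ι (u k) ∉ g.causalFuture τ L := by
    intro k hk
    rw [causalFuture_eq_biUnion] at hk
    simp only [mem_iUnion, exists_prop] at hk
    obtain ⟨_, ⟨o, ho, rfl⟩, hle⟩ := hk
    have heq : ι (u k) = ι o := hac (ι o) ⟨o, rfl⟩ _ ⟨u k, rfl⟩ hle
    exact huK k (hιi heq ▸ ho)
  have hxsint : ∀ k, xs k ∈ interior (g.causalFuture τ L) := fun k ↦ hIL (hxL _ (hxxs k))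
  -- the causal curves `β k` from `ι (u k)` to `xs k` and their first entries `w k` into `J⁺(L)`
  have hw : ∀ k, ∃ w : M, w ∈ g.causalFuture τ L ∧ w ∉ interior (g.causalFuture τ L) ∧
      w ∈ g.causalPast τ {xs k} ∧ w ∈ g.causalFuture τ {ι (u k)} ∧ w ≠ ι (u k) := by
    intro k
    have h := mem_causalPast_singleton_iff.1 (huJ k)
    rcases h with h | ⟨p, hp, β, a', b', hab', hβ, hβa, hβb⟩
    · -- `xs k = ι (u k)` is impossible: `xs k ∈ I⁺(S)` is off `S`
      exfalso
      rw [mem_singleton_iff] at h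
      exact not_mem_range_of_mem_chronologicalFuture_range hcwb hac
        (chronologicalFuture_mono hLS (hxL _ (hxxs k))) ⟨u k, h.symm⟩
    rw [mem_singleton_iff] at hp
    rw [hp] at hβa
    obtain ⟨t, ht, htF, htint, -⟩ := exists_first_entry hJLc hab'.le
      (fun s hs ↦ (hβ s hs).1.continuousAt.continuousWithinAt) (by rw [hβa]; exact hsL k)
      (by rw [hβb]; exact interior_subset (hxsint k))
    refine ⟨β t, htF, htint, ?_, ?_, ?_⟩
    · -- `β t ≤ xs k`
      refine mem_causalPast_singleton_iff.2 ?_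
      rcases eq_or_lt_of_le ht.2 with heq | hlt
      · rw [heq, hβb]; exact subset_causalFuture g τ _ rfl
      · rw [← hβb]
        exact Or.inr ⟨β t, rfl, β, t, b', hlt, hβ.mono (Icc_subset_Icc ht.1.le le_rfl), rfl, rfl⟩
    · -- `ι (u k) ≤ β t`
      rw [← hβa]
      exact Or.inr ⟨β a', rfl, β, a', t, ht.1, hβ.mono (Icc_subset_Icc le_rfl ht.2), rfl, rfl⟩
    · -- `β t ≠ ι (u k)` (no closed causal curves)
      intro heq
      exact hcwb β a' t ht.1 (hβ.mono (Icc_subset_Icc le_rfl ht.2)) (by rw [hβa, heq])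
  choose w hwJ hwint hwxs hwu hwne using hw
  -- the `w k` lie in the compact `J⁺(L) ∩ J⁻(c b)`; extract a convergent subsequence
  set K₀ : Set M := g.causalFuture τ L ∩ g.causalPast τ {c b} with hK₀
  have hK₀c : IsCompact K₀ := hKC L hLc (c b)
  have hwK₀ : ∀ k, w k ∈ K₀ := fun k ↦ ⟨hwJ k, mem_causalPast_singleton_iff.2
    (mem_causalFuture_of_mem_causalFuture_of_mem_causalFuture hn
      (mem_causalPast_singleton_iff.1 (hwxs k))
      (chronologicalFuture_subset_causalFuture g τ _ (hxsb k)))⟩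
  obtain ⟨w₀, -, φ, hφ, hφw⟩ := hK₀c.tendsto_subseq hwK₀
  -- `w₀ ≤ x`, `w₀ ∈ J⁺(L)`, `w₀ ∉ int J⁺(L)`
  have hw₀x : c a ∈ g.causalFuture τ {w₀} :=
    hrel hφw (hxs_lim.comp hφ.tendsto_atTop) fun j ↦ mem_causalPast_singleton_iff.1 (hwxs (φ j))
  have hw₀J : w₀ ∈ g.causalFuture τ L := hJLc.mem_of_tendsto hφw (Eventually.of_forall fun j ↦ hwJ _)
  have hw₀int : w₀ ∉ interior (g.causalFuture τ L) := by
    have hcl : IsClosed (interior (g.causalFuture τ L))ᶜ := isOpen_interior.isClosed_compl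
    exact hcl.mem_of_tendsto hφw (Eventually.of_forall fun j ↦ hwint _)
  -- no point of `S` is chronologically below `w₀`
  have hIw : ∀ v : X', w₀ ∉ g.chronologicalFuture τ {ι v} := by
    intro v hv
    -- `ι v ≪ w₀ ≤ x`, so `v ∈ K ⊆ K'` and `ι v ∈ L`: then `w₀ ∈ I⁺(L) ⊆ int J⁺(L)`
    have hvx : c a ∈ g.chronologicalFuture τ {ι v} :=
      mem_chronologicalFuture_of_mem_chronologicalFuture_of_mem_causalFuture hn1 hv hw₀x
    have hvK' : v ∈ K' := interior_subset (hKK' (hsh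
      (mem_causalPast_singleton_iff.2 (chronologicalFuture_subset_causalFuture g τ _ hvx))))
    exact hw₀int (hIL (chronologicalFuture_mono (show ({ι v} : Set M) ⊆ L from
      singleton_subset_iff.2 ⟨v, hvK', rfl⟩) hv))
  -- `l ≤ w₀` for some `l = ι v ∈ L`
  have hl := hw₀J
  rw [causalFuture_eq_biUnion] at hl
  simp only [mem_iUnion, exists_prop] at hl
  obtain ⟨_, ⟨v, hvK', rfl⟩, hvw₀⟩ := hl
  by_cases hveq : w₀ = ι v
  · -- `w₀ = ι v ∈ S ∩ J⁻(x)`: `v ∈ K ⊆ int K'`; run the trichotomy at `v` with `O = int K'`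
    have hvK : v ∈ interior K' :=
      hKK' (hsh (mem_causalPast_singleton_iff.2 (by rw [← hveq]; exact hw₀x)))
    obtain ⟨B, hBo, hvB, hBO⟩ := hLT v (interior K') isOpen_interior hvK
    rw [← hveq] at hvB
    have hev : ∀ᶠ j in atTop, w (φ j) ∈ B := hφw (hBo.mem_nhds hvB)
    obtain ⟨j, hj⟩ := hev.exists
    have hOL : ι '' interior K' ⊆ L := image_mono interior_subset
    rcases hBO hj with (hS | hfut) | hpast
    · -- `w (φ j) = ι o`, `o ∈ int K'`, while `ι (u _) ≤ w (φ j)` forces `w (φ j) = ι (u _)`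
      obtain ⟨o, ho, hoe⟩ := hS
      have heq : w (φ j) = ι (u (φ j)) :=
        hac _ ⟨u (φ j), rfl⟩ _ ⟨o, hoe⟩ (hwu (φ j))
      exact hwne (φ j) heq
    · -- `w (φ j) ∈ I⁺(ι O) ⊆ int J⁺(L)`
      exact hwint (φ j) (hIL (chronologicalFuture_mono hOL hfut))
    · -- `w (φ j) ∈ I⁻(ι O)`: `ι (u _) ≤ w (φ j) ≪ ι o`, two related points of `S`
      rw [chronologicalPast, chronologicalFuture_eq_biUnion] at hpast
      simp only [mem_iUnion, exists_prop] at hpast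
      obtain ⟨z, hz, hzw⟩ := hpast
      have h1 : z ∈ g.chronologicalFuture τ {w (φ j)} :=
        mem_chronologicalFuture_of_mem_chronologicalPast hzw
      have h2 : z ∈ g.chronologicalFuture τ {ι (u (φ j))} :=
        mem_chronologicalFuture_of_mem_causalFuture hn1 (hwu (φ j)) h1
      exact not_mem_range_of_mem_chronologicalFuture_range hcwb hac
        (chronologicalFuture_mono (show ({ι (u (φ j))} : Set M) ⊆ range ι from
          singleton_subset_iff.2 ⟨u (φ j), rfl⟩) h2) (hOL.trans hLS hz)
  · -- `ι v < w₀` strictly: `w₀ ∉ S` (acausality), so `w₀ ∈ I⁺(S)` — against `hIw`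
    have hw₀S : w₀ ∉ range ι := fun hS ↦ hveq (hac (ι v) ⟨v, rfl⟩ w₀ hS hvw₀)
    have hw₀I : w₀ ∈ g.chronologicalFuture τ (range ι) := by
      rcases hJS (causalFuture_mono (show ({ι v} : Set M) ⊆ range ι from
        singleton_subset_iff.2 ⟨v, rfl⟩) hvw₀) with h | h
      · exact absurd h hw₀S
      · exact h
    rw [chronologicalFuture_eq_biUnion] at hw₀I
    simp only [mem_iUnion, exists_prop] at hw₀I
    obtain ⟨_, ⟨v', rfl⟩, hv'⟩ := hw₀I
    exact hIw v' hv'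

/-- **Time dual: compact shadows persist slightly to the past.** If `x ∈ ι(X) ∪ I⁻(ι X)` has
`ι⁻¹ J⁺(x)` contained in a compact set, then so does some `x⁻ ≪ x`.
[cite: ONeillSemiRiemannian1983, Ch. 14, Lemma 14.43 (pp. 425–426)] -/
theorem exists_gg_compactShadow (hn : 2 ≤ n) (hcwb : g.IsCausallyWellBehaved τ)
    {X' : Type*} [TopologicalSpace X'] [LocallyCompactSpace X'] {ι : X' → M}
    (hιc : Continuous ι) (hιi : Injective ι)
    (hac : ∀ p ∈ range ι, ∀ q ∈ range ι, q ∈ g.causalFuture τ {p} → q = p)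
    (hLT : ∀ (u : X') (O : Set X'), IsOpen O → u ∈ O → ∃ B : Set M, IsOpen B ∧ ι u ∈ B ∧
      B ⊆ ι '' O ∪ g.chronologicalFuture τ (ι '' O) ∪ g.chronologicalPast τ (ι '' O))
    (hrel : ∀ {xs ys : ℕ → M} {x y : M}, Tendsto xs atTop (𝓝 x) → Tendsto ys atTop (𝓝 y) →
      (∀ j, ys j ∈ g.causalFuture τ {xs j}) → y ∈ g.causalFuture τ {x})
    (hKC' : ∀ C : Set M, IsCompact C → ∀ y : M,
      IsCompact (g.causalPast τ C ∩ g.causalFuture τ {y}))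
    {x : M} (hx : x ∈ range ι ∨ x ∈ g.chronologicalPast τ (range ι))
    {K : Set X'} (hK : IsCompact K) (hsh : ι ⁻¹' g.causalFuture τ {x} ⊆ K) :
    ∃ x' ∈ g.chronologicalPast τ {x}, ∃ K' : Set X', IsCompact K' ∧
      ι ⁻¹' g.causalFuture τ {x'} ⊆ K' := by
  have hac' : ∀ p ∈ range ι, ∀ q ∈ range ι, q ∈ g.causalFuture τ.reverse {p} → q = p :=
    fun p hp q hq h ↦ (hac q hq p hp (mem_causalPast_singleton_iff.1 h)).symm
  have hLT' : ∀ (u : X') (O : Set X'), IsOpen O → u ∈ O → ∃ B : Set M, IsOpen B ∧ ι u ∈ B ∧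
      B ⊆ ι '' O ∪ g.chronologicalFuture τ.reverse (ι '' O) ∪
        g.chronologicalPast τ.reverse (ι '' O) := by
    intro u O hO huO
    obtain ⟨B, hB, huB, hBO⟩ := hLT u O hO huO
    refine ⟨B, hB, huB, fun y hy ↦ ?_⟩
    rw [chronologicalPast_reverse]
    rcases hBO hy with (h | h) | h
    · exact Or.inl (Or.inl h)
    · exact Or.inr h
    · exact Or.inl (Or.inr h)
  have hrel' : ∀ {xs ys : ℕ → M} {x y : M}, Tendsto xs atTop (𝓝 x) → Tendsto ys atTop (𝓝 y) →
      (∀ j, ys j ∈ g.causalFuture τ.reverse {xs j}) → y ∈ g.causalFuture τ.reverse {x} := by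
    intro xs ys x y hx hy h
    show y ∈ g.causalPast τ {x}
    exact mem_causalPast_singleton_iff.2 (hrel hy hx fun j ↦ mem_causalPast_singleton_iff.1 (h j))
  have hKC'' : ∀ C : Set M, IsCompact C → ∀ y : M,
      IsCompact (g.causalFuture τ.reverse C ∩ g.causalPast τ.reverse {y}) := by
    intro C hC y
    rw [causalPast_reverse]
    exact hKC' C hC y
  have hsh' : ι ⁻¹' g.causalPast τ.reverse {x} ⊆ K := by rw [causalPast_reverse]; exact hsh
  obtain ⟨x', hx', K', hK', hsh''⟩ := exists_ll_compactShadow (τ := τ.reverse) hn hcwb.reverse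
    hιc hιi hac' hLT' hrel' hKC'' hx hK hsh'
  refine ⟨x', hx', K', hK', ?_⟩
  rw [causalPast_reverse] at hsh''
  exact hsh''

end Causal

end LorentzianMetric

end Literature.Geometry.Lorentzian

end
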